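/-
Copyright: the b2b-balaban T⁴-continuum CRUX team, row NE7b, leaf lineage `t4-ne7b-formalise-leaf-02` (gen 132). Project licence.
-/
import Summits.QuantumFields.BalabanUV.T4Continuum.Spine.NE7b.OneStepCoarseCurlBound
import Summits.QuantumFields.BalabanUV.T4Continuum.Spine.NE7b.BlockSquareCounting
import Summits.QuantumFields.BalabanUV.T4Continuum.Spine.NE7b.TorusSquareReindexing

/-!
# THE (h1) SLOT AT ONE STEP, END BY VALUE: on the two-scale torus `(ℤ∕LM)^d`, for `LM`-periodic data read through [B7]'s `ℤ^d` objects,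
# `Σ_P ‖(∂_{V̄₀} Q₀A)(P)‖² ≤ 2·L^{2−d}(1+2Lα₀)²·Σ_q ‖F_A(q)‖² + 4(d−1)(L+2)²·L^{−d}·ε²·Σ_b ‖A(b)‖²`, `ε = 2L(L+1)α₀ + 1920(d+1)(d+4)L²α₀`
# — Lemma CS (i)+(ii) at `k = 1` (`…OneStepCoarseCurlBound`) periodised (`…TorusSquareReindexing`) and counted (`…BlockSquareCounting`)
# (row NE7b, node U5c; `HOME/b2b-balaban-r1/SectE-interface-proof.md` §5.2 (5.2) at `k = 1`: «`Σ_P |(∂_V M_kA)(P)|² ≤ 8‖D_UA‖² +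
# 32(d−1)c_g²ε_F²‖A‖²`»; E-side key reading — the junction of this lineage's `k = 1` chain)

Cell `pub-balaban`, sub-cell `t4`, spine estimate NE7b (`T4WeightBudget.RelWeightBound`; the cell's OWN estimate — NOT PRINTED in
[Bałaban 1983–89], NOT PROVED).  Crux-route work under `Spine/NE7b/` by the row's E-side ∕ key-readings ∕ lattice-geometry leaf lineage; a
[folklore] junction BY NAME; NOTHING of Bałaban's is asserted beyond what the imported modules prove; no `T4Continuum/Support` leaf typed; no
`def`, no notation, no instance — the torus data `Xv` (coarse curls at the block base points `qb y = L·val(y)`), `Fq` (fine covariant curls),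
`Ab` (the 1-form) and the Finsets `Sq`, `Bd`, `Gr` are carried by characterising hypotheses (`hXv`, `hF`, `hA` — the last two ENCODE the
`LM`-periodicity of `(V₀, A)`: a function of the class `tcls (LM) y` — and `hSq ∕ hBd ∕ hGr` of the counting files, verbatim); zero `sorry`.

WHAT IS PROVED ([folklore]): **`sum_sq_coarseCurl_le`** — for `𝔸` a non-trivial C⋆-algebra, a `GaugeGroup G` with `ι : G →* 𝔸ˣ` unitary-valued
reading `dist1` (`hιu`, `hdist`), `U : bonds(ℤ^d) → G`, `V₀ = ι ∘ U`, `‖V₀(∂p) − 1‖ ≤ α₀` ((44)'s letter), `512(d+1)(d+4)L²α₀ ≤ 1`, `1 ≤ L`,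
`M ≥ 1` (`[NeZero M]`, `[NeZero (L*M)]` for the torus `Fintype`s), a 1-form `A`, and torus data as above:
`Σ_{P=(y,a)} Xv(P)² ≤ 2·L^{−d}·Σ_q (L(1+2Lα₀)·Fq q)² + 4(d−1)(L+2)²·L^{−d}·ε²·Σ_b (Ab b)²`, `ε = 2L(L+1)α₀ + 1920(d+1)(d+4)L²α₀` —
`…BlockSquareCounting.sum_sq_le_twoScale_rows` with `av P r := (1+2Lα₀)L⁻¹·Σ_{q∈Sq} Fq q`, `F := L(1+2Lα₀)·Fq`, its `hX` supplied per block point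
by `…OneStepCoarseCurlBound.norm_coarseCurl_Q0cov_bavg_le_curls` + `…TorusSquareReindexing` (curls `=`, the five 1-form families `≤ Σ_{Gr∪Bd}`,
the triangular family `Σ_{j<L}Σ_{i<j} ≤ L·Σ_{i<L}`).

HONEST SHAPE.  Against the memo's (5.2): curl constant `2L^{2−d}(1+2Lα₀)²` in lattice units (the memo's `8η^d(1+ε_F)²` up to its `L²∕η`
normalisation of the coarse curl — NOT HERE), 1-form constant `4(d−1)(L+2)²L^{−d}ε²` with `ε = O(d²L²α₀)` (the memo's `32(d−1)c_g²ε_F²η^d`; the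
extra `(L+2)²` is the interior-row term of the typed Lemma CS (i)).  NOT HERE: the `L²(η)` normalisations and the identification with CED's
`(p, q)` letters (`…CurlFormEnergyDomination`, `…AveragedCurlFormSplit`), (R-M) (`…OneStepAveragingRemainder`), `k > 1`, the cell's `U(n)` instance
(one line from `…OneStepCoarseCurlBound` §2's letters), anything of Bałaban's ((A3) ∕ (A1c), NC-NE7b-α UNRULED).  BY-NAME EFFECT ON THE WALL:
NONE (the (h1) slot's `k = 1` END by value; the wall is (R2)).  NE7b NOT PRINTED ∕ NOT PROVED; spine PROVED 0∕9; rung (B)+1 on a FINITE torus —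
NOT infinite volume, NOT the mass gap, NOT Clay.
HONEST DEPENDENCY: continuum YM on T⁴ ⇐ BetaPertH ∧ nine spine estimates (0/9 proved); BetaPertH ⇐ (D1) ∧ (D4) ∧ CAP+tail; G-an2-4 gates
asym, D1 and NE2/3/4.
-/

set_option autoImplicit false

noncomputable section

open scoped BigOperators
open Finset
open Literature.MathematicalPhysics.QuantumFieldTheory.Balaban1983to89 (GaugeGroup dist1)
open Literature.MathematicalPhysics.QuantumFieldTheory.Balaban1983to89.B7Prop1Explicit (Site e hol seg treeWord boxVec bavg plaqWord U1)
open Literature.MathematicalPhysics.QuantumFieldTheory.Balaban1983to89.B7Prop2Explicit (unitaryUnits)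
open Literature.MathematicalPhysics.QuantumFieldTheory.Balaban1983to89.B7Eq78Linearization (conjR)
open Literature.MathematicalPhysics.QuantumFieldTheory.Balaban1983to89.B7Prop3GeneralRotated (tsum)
open Literature.MathematicalPhysics.QuantumFieldTheory.Balaban1983to89.B7Prop3GeneralLinear (Q0cov)
open Literature.MathematicalPhysics.QuantumFieldTheory.Balaban1983to89.T4TermwiseTorus (tcls tcls_tlift tlift)
open Summit.QuantumFields.BalabanUV.T4Continuum.NE7b.NonAbelianStokesBound (rectWord)

namespace Summit.QuantumFields.BalabanUV.T4Continuum.NE7b.OneStepCoarseCurlL2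

variable {d : ℕ}
variable {𝔸 : Type*} [CStarAlgebra 𝔸] [Nontrivial 𝔸] {G : Type*} [GaugeGroup G]
  (ι : G →* 𝔸ˣ) (hιu : ∀ g, ι g ∈ unitaryUnits 𝔸) (hdist : ∀ g, ‖((ι g : 𝔸ˣ) : 𝔸) - 1‖ = dist1 g)
  (L M : ℕ) [NeZero M] [NeZero (L * M)] (hL : 1 ≤ L) {α₀ : ℝ} (hα₀ : 0 ≤ α₀) (hsmall : 512 * (d + 1) * (d + 4) * (L : ℝ) ^ 2 * α₀ ≤ 1)
  (U : Site d → Fin d → G) {V₀ : Site d → Fin d → 𝔸ˣ} (hV₀ : ∀ y ν, V₀ y ν = ι (U y ν))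
  (h44 : ∀ (x : Site d) (κ κ' : Fin d), κ ≠ κ' → ‖((hol V₀ x (plaqWord κ κ') : 𝔸ˣ) : 𝔸) - 1‖ ≤ α₀)
  (A : Site d → Fin d → 𝔸)
  -- the torus Finsets of the counting files (hypotheses verbatim)
  (Sq : (Fin d → ZMod (L * M)) → {a : Fin d × Fin d // a.1 < a.2} →
    Finset ((Fin d → ZMod (L * M)) × {a : Fin d × Fin d // a.1 < a.2}))
  (hSq : ∀ x a, Sq x a = univ.image (fun ij : Fin L × Fin L =>
    (x + Pi.single a.1.1 ((ij.1 : ℕ) : ZMod (L * M)) + Pi.single a.1.2 ((ij.2 : ℕ) : ZMod (L * M)), a)))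
  (Bd : (Fin d → ZMod (L * M)) → {a : Fin d × Fin d // a.1 < a.2} → Finset ((Fin d → ZMod (L * M)) × Fin d))
  (hBd : ∀ x a, Bd x a = univ.image (fun csi : Bool × Bool × Fin L =>
      if csi.1 then
        (if csi.2.1 then x + Pi.single a.1.1 ((csi.2.2 : ℕ) : ZMod (L * M))
          else x + Pi.single a.1.2 (L : ZMod (L * M)) + Pi.single a.1.1 ((csi.2.2 : ℕ) : ZMod (L * M)), a.1.1)
      else
        (if csi.2.1 then x + Pi.single a.1.2 ((csi.2.2 : ℕ) : ZMod (L * M))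
          else x + Pi.single a.1.1 (L : ZMod (L * M)) + Pi.single a.1.2 ((csi.2.2 : ℕ) : ZMod (L * M)), a.1.2)))
  (Gr : (Fin d → ZMod (L * M)) → {a : Fin d × Fin d // a.1 < a.2} → Finset ((Fin d → ZMod (L * M)) × Fin d))
  (hGr : ∀ x a, Gr x a = univ.image (fun cij : Bool × Fin L × Fin L =>
      (x + Pi.single a.1.1 ((cij.2.1 : ℕ) : ZMod (L * M)) + Pi.single a.1.2 ((cij.2.2 : ℕ) : ZMod (L * M)),
        if cij.1 then a.1.1 else a.1.2)))
  -- the torus data, characterised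
  (qb : (Fin d → ZMod M) → Site d) (hqb : ∀ y i, qb y i = (L : ℤ) * (((y i).val : ℕ) : ℤ))
  (Xv : (Fin d → ZMod M) × {a : Fin d × Fin d // a.1 < a.2} → ℝ)
  (hXv : ∀ p, Xv p =
    ‖Q0cov L V₀ A (qb p.1) p.2.1.1 + conjR (bavg L V₀ (qb p.1) p.2.1.1) (Q0cov L V₀ A (qb p.1 + (L : ℤ) • e p.2.1.1) p.2.1.2)
      - conjR (bavg L V₀ (qb p.1) p.2.1.1 * bavg L V₀ (qb p.1 + (L : ℤ) • e p.2.1.1) p.2.1.2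
          * (bavg L V₀ (qb p.1 + (L : ℤ) • e p.2.1.2) p.2.1.1)⁻¹) (Q0cov L V₀ A (qb p.1 + (L : ℤ) • e p.2.1.2) p.2.1.1)
      - conjR (bavg L V₀ (qb p.1) p.2.1.1 * bavg L V₀ (qb p.1 + (L : ℤ) • e p.2.1.1) p.2.1.2
          * (bavg L V₀ (qb p.1 + (L : ℤ) • e p.2.1.2) p.2.1.1)⁻¹ * (bavg L V₀ (qb p.1) p.2.1.2)⁻¹) (Q0cov L V₀ A (qb p.1) p.2.1.2)‖)
  (Fq : (Fin d → ZMod (L * M)) × {a : Fin d × Fin d // a.1 < a.2} → ℝ)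
  (hF : ∀ (y : Site d) (a : {a : Fin d × Fin d // a.1 < a.2}), Fq (tcls (L * M) y, a) = ‖tsum V₀ A y (plaqWord a.1.1 a.1.2)‖)
  (Ab : (Fin d → ZMod (L * M)) × Fin d → ℝ) (hA : ∀ (y : Site d) (ν : Fin d), Ab (tcls (L * M) y, ν) = ‖A y ν‖)

include hιu hdist hL hα₀ hsmall hV₀ h44 hSq hBd hGr hqb hXv hF hA in
/-- **THE (h1) SLOT AT `k = 1`, END BY VALUE ON THE TWO-SCALE TORUS.**  See the module docstring. [folklore] -/
theorem sum_sq_coarseCurl_le :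
    ∑ p, Xv p ^ 2
      ≤ 2 * (1 / (L : ℝ) ^ d) * ∑ q, ((L : ℝ) * (1 + 2 * ((L : ℝ) * α₀)) * Fq q) ^ 2
        + 4 * ((d - 1 : ℕ) : ℝ) * ((L : ℝ) + 2) ^ 2 * (1 / (L : ℝ) ^ d)
          * (2 * (L : ℝ) * ((L : ℝ) + 1) * α₀ + 1920 * (d + 1) * (d + 4) * (L : ℝ) ^ 2 * α₀) ^ 2 * ∑ b, Ab b ^ 2 := by
  classical
  have hLpos : 0 < L := hL
  have hLN : L ≤ L * M := Nat.le_mul_of_pos_right L (Nat.pos_of_ne_zero (NeZero.ne M))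
  have hL0 : (0 : ℝ) < (L : ℝ) := by exact_mod_cast hLpos
  have hF0 : ∀ q, 0 ≤ Fq q := by
    rintro ⟨q1, q2⟩
    rw [← tcls_tlift q1, hF]
    exact norm_nonneg _
  have hA0 : ∀ b, 0 ≤ Ab b := by
    rintro ⟨b1, b2⟩
    rw [← tcls_tlift b1, hA]
    exact norm_nonneg _
  have hLα : 0 ≤ (L : ℝ) * α₀ := by positivity
  have hδ : (0 : ℝ) ≤ 320 * (d + 1) * (d + 4) * (L : ℝ) ^ 2 * α₀ := by positivity
  refine BlockSquareCounting.sum_sq_le_twoScale_rows L Sq hSq Bd hBd Gr hGr hLpos Xv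
    (fun p r => (1 + 2 * ((L : ℝ) * α₀)) / (L : ℝ)
      * ∑ q ∈ Sq (fun i => ((((p.1 i).val * L + (r i : ℕ) : ℕ)) : ZMod (L * M))) p.2, Fq q)
    (fun q => (L : ℝ) * (1 + 2 * ((L : ℝ) * α₀)) * Fq q) Ab
    (ε := 2 * (L : ℝ) * ((L : ℝ) + 1) * α₀ + 1920 * (d + 1) * (d + 4) * (L : ℝ) ^ 2 * α₀) (by positivity) ?_ ?_ ?_
  · -- `0 ≤ av`
    intro p r
    exact mul_nonneg (by positivity) (Finset.sum_nonneg fun q _ => hF0 q)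
  · -- `av ≤ Σ_{q∈Sq} L⁻²·|F q|` (an equality)
    intro p r
    rw [Finset.mul_sum]
    refine Finset.sum_le_sum fun q _ => le_of_eq ?_
    rw [abs_of_nonneg (by have := hF0 q; positivity)]
    field_simp
  · -- the letter `hX`, per coarse plaquette
    rintro ⟨y, a⟩
    have hκμ : a.1.1 ≠ a.1.2 := ne_of_lt a.2
    rw [hXv, abs_norm]
    refine (OneStepCoarseCurlBound.norm_coarseCurl_Q0cov_bavg_le_curls ι hιu hdist L hL hα₀ hsmall U hV₀ h44 A (qb y) hκμ).trans
      (Finset.sum_le_sum fun r _ => ?_)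
    -- the block point
    have hblk : tcls (L * M) (qb y + boxVec L r) = fun i => ((((y i).val * L + (r i : ℕ) : ℕ)) : ZMod (L * M)) := by
      have hq : qb y = fun i => (L : ℤ) * (((y i).val : ℕ) : ℤ) := funext (hqb y)
      rw [hq]
      exact TorusSquareReindexing.tcls_blockBase_add_boxVec L y r
    -- the curls: `ℤ^d` double sum = torus sum over `Sq`
    have hC : ∑ j ∈ Finset.range L, ∑ i ∈ Finset.range L,
          ‖tsum V₀ A (qb y + boxVec L r + (i : ℤ) • e a.1.1 + (j : ℤ) • e a.1.2) (plaqWord a.1.1 a.1.2)‖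
        = ∑ q ∈ Sq (fun i => ((((y i).val * L + (r i : ℕ) : ℕ)) : ZMod (L * M))) a, Fq q := by
      rw [← hblk, ← TorusSquareReindexing.sum_sq_tcls_eq_sum_Sq (L * M) L Sq hSq hLN (qb y + boxVec L r) a Fq]
      simp_rw [hF]
    -- the 1-form families against `W = Σ_{Gr ∪ Bd} Ab`
    have hW0 : 0 ≤ ∑ b ∈ Gr (fun i => ((((y i).val * L + (r i : ℕ) : ℕ)) : ZMod (L * M))) a
        ∪ Bd (fun i => ((((y i).val * L + (r i : ℕ) : ℕ)) : ZMod (L * M))) a, Ab b :=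
      Finset.sum_nonneg fun b _ => hA0 b
    have hT2 : ∑ j ∈ Finset.range L, ∑ i ∈ Finset.range L, ‖A (qb y + boxVec L r + (j : ℤ) • e a.1.2 + (i : ℤ) • e a.1.1) a.1.1‖
        ≤ ∑ b ∈ Gr (fun i => ((((y i).val * L + (r i : ℕ) : ℕ)) : ZMod (L * M))) a
          ∪ Bd (fun i => ((((y i).val * L + (r i : ℕ) : ℕ)) : ZMod (L * M))) a, Ab b := by
      rw [← hblk]; simp_rw [← hA]
      exact TorusSquareReindexing.sum_rows_tcls_le (L * M) L Bd Gr hGr hLN (qb y + boxVec L r) a Ab hA0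
    have hS3 : ∑ i ∈ Finset.range L, ‖A (qb y + boxVec L r + (i : ℤ) • e a.1.2) a.1.2‖
        ≤ ∑ b ∈ Gr (fun i => ((((y i).val * L + (r i : ℕ) : ℕ)) : ZMod (L * M))) a
          ∪ Bd (fun i => ((((y i).val * L + (r i : ℕ) : ℕ)) : ZMod (L * M))) a, Ab b := by
      rw [← hblk]; simp_rw [← hA]
      exact TorusSquareReindexing.sum_col_tcls_le (L * M) L Bd hBd Gr hLN (qb y + boxVec L r) a Ab hA0
    have hS1 : ∑ i ∈ Finset.range L, ‖A (qb y + boxVec L r + (L : ℤ) • e a.1.1 + (i : ℤ) • e a.1.2) a.1.2‖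
        ≤ ∑ b ∈ Gr (fun i => ((((y i).val * L + (r i : ℕ) : ℕ)) : ZMod (L * M))) a
          ∪ Bd (fun i => ((((y i).val * L + (r i : ℕ) : ℕ)) : ZMod (L * M))) a, Ab b := by
      rw [← hblk]; simp_rw [← hA]
      exact TorusSquareReindexing.sum_farμ_tcls_le (L * M) L Bd hBd Gr hLN (qb y + boxVec L r) a Ab hA0
    have hS2 : ∑ i ∈ Finset.range L, ‖A (qb y + boxVec L r + (L : ℤ) • e a.1.2 + (i : ℤ) • e a.1.1) a.1.1‖
        ≤ ∑ b ∈ Gr (fun i => ((((y i).val * L + (r i : ℕ) : ℕ)) : ZMod (L * M))) a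
          ∪ Bd (fun i => ((((y i).val * L + (r i : ℕ) : ℕ)) : ZMod (L * M))) a, Ab b := by
      rw [← hblk]; simp_rw [← hA]
      exact TorusSquareReindexing.sum_farκ_tcls_le (L * M) L Bd hBd Gr hLN (qb y + boxVec L r) a Ab hA0
    have hT1 : ∑ j ∈ Finset.range L, ∑ i ∈ Finset.range j, ‖A (qb y + boxVec L r + (i : ℤ) • e a.1.2) a.1.2‖
        ≤ (L : ℝ) * ∑ b ∈ Gr (fun i => ((((y i).val * L + (r i : ℕ) : ℕ)) : ZMod (L * M))) a
          ∪ Bd (fun i => ((((y i).val * L + (r i : ℕ) : ℕ)) : ZMod (L * M))) a, Ab b := by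
      calc ∑ j ∈ Finset.range L, ∑ i ∈ Finset.range j, ‖A (qb y + boxVec L r + (i : ℤ) • e a.1.2) a.1.2‖
          ≤ ∑ _j ∈ Finset.range L, ∑ i ∈ Finset.range L, ‖A (qb y + boxVec L r + (i : ℤ) • e a.1.2) a.1.2‖ :=
            Finset.sum_le_sum fun j hj => Finset.sum_le_sum_of_subset_of_nonneg
              (Finset.range_mono (le_of_lt (Finset.mem_range.1 hj))) (fun _ _ _ => norm_nonneg _)
        _ = (L : ℝ) * ∑ i ∈ Finset.range L, ‖A (qb y + boxVec L r + (i : ℤ) • e a.1.2) a.1.2‖ := by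
            rw [Finset.sum_const, Finset.card_range, nsmul_eq_mul]
        _ ≤ _ := mul_le_mul_of_nonneg_left hS3 hL0.le
    have hWabs : ∑ b ∈ Gr (fun i => ((((y i).val * L + (r i : ℕ) : ℕ)) : ZMod (L * M))) a
          ∪ Bd (fun i => ((((y i).val * L + (r i : ℕ) : ℕ)) : ZMod (L * M))) a, (1 / (L : ℝ)) * |Ab b|
        = (1 / (L : ℝ)) * ∑ b ∈ Gr (fun i => ((((y i).val * L + (r i : ℕ) : ℕ)) : ZMod (L * M))) a
          ∪ Bd (fun i => ((((y i).val * L + (r i : ℕ) : ℕ)) : ZMod (L * M))) a, Ab b := by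
      rw [Finset.mul_sum]
      exact Finset.sum_congr rfl fun b _ => by rw [abs_of_nonneg (hA0 b)]
    rw [hC, hWabs]
    -- bookkeeping of the constants
    set W := ∑ b ∈ Gr (fun i => ((((y i).val * L + (r i : ℕ) : ℕ)) : ZMod (L * M))) a
          ∪ Bd (fun i => ((((y i).val * L + (r i : ℕ) : ℕ)) : ZMod (L * M))) a, Ab b with hWdef
    set C := ∑ q ∈ Sq (fun i => ((((y i).val * L + (r i : ℕ) : ℕ)) : ZMod (L * M))) a, Fq q with hCdef
    have hC0 : 0 ≤ C := Finset.sum_nonneg fun q _ => hF0 q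
    have h1 : 2 * ((L : ℝ) * α₀) * (∑ j ∈ Finset.range L, ∑ i ∈ Finset.range j, ‖A (qb y + boxVec L r + (i : ℤ) • e a.1.2) a.1.2‖
          + ∑ j ∈ Finset.range L, ∑ i ∈ Finset.range L, ‖A (qb y + boxVec L r + (j : ℤ) • e a.1.2 + (i : ℤ) • e a.1.1) a.1.1‖)
        ≤ 2 * ((L : ℝ) * α₀) * ((L : ℝ) * W + W) :=
      mul_le_mul_of_nonneg_left (add_le_add hT1 hT2) (by positivity)
    have h2 : 2 * (320 * (d + 1) * (d + 4) * (L : ℝ) ^ 2 * α₀)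
          * (∑ i ∈ Finset.range L, ‖A (qb y + boxVec L r + (L : ℤ) • e a.1.1 + (i : ℤ) • e a.1.2) a.1.2‖
            + ∑ i ∈ Finset.range L, ‖A (qb y + boxVec L r + (L : ℤ) • e a.1.2 + (i : ℤ) • e a.1.1) a.1.1‖
            + ∑ i ∈ Finset.range L, ‖A (qb y + boxVec L r + (i : ℤ) • e a.1.2) a.1.2‖)
        ≤ 2 * (320 * (d + 1) * (d + 4) * (L : ℝ) ^ 2 * α₀) * (W + W + W) :=
      mul_le_mul_of_nonneg_left (add_le_add (add_le_add hS1 hS2) hS3) (by positivity)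
    have hfin : ((L : ℝ) ^ (d + 1))⁻¹ * ((1 + 2 * ((L : ℝ) * α₀)) * C + 2 * ((L : ℝ) * α₀) * ((L : ℝ) * W + W)
          + 2 * (320 * (d + 1) * (d + 4) * (L : ℝ) ^ 2 * α₀) * (W + W + W))
        = 1 / (L : ℝ) ^ d * ((1 + 2 * ((L : ℝ) * α₀)) / (L : ℝ) * C
          + (2 * (L : ℝ) * ((L : ℝ) + 1) * α₀ + 1920 * (d + 1) * (d + 4) * (L : ℝ) ^ 2 * α₀) * (1 / (L : ℝ) * W)) := by
      field_simp
      ring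
    rw [← hfin]
    exact mul_le_mul_of_nonneg_left (by linarith [h1, h2]) (by positivity)

end Summit.QuantumFields.BalabanUV.T4Continuum.NE7b.OneStepCoarseCurlL2

end
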